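import Literature.AlgebraicGeometry.Frobenioids.RlfStructure
import Literature.AlgebraicGeometry.Frobenioids.PerfFactorialWeakFinite
import HarnessLib

/-!
# Frobenioids I, Def. 2.4 (i), WEAK form: the structure of the realification `M^rlf` of a WEAKLY
# perf-factorial monoid — perfect, divisorial, order

Mochizuki, *The geometry of Frobenioids I*, Kyushu J. Math. **62** (2008), §2, Definition 2.4 (i),
kurims p. 48 [cite: MochizukiFrdI2008, Def. 2.4(i) p.48].  Weak-hypothesis twin of `RlfStructure.lean`
(seat abc-iut-L1-d2): `M` is only WEAKLY perf-factorial (`IsPerfFactorialWeak` = (a)(b)(c) + (d_ord) +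
(d_res), the abc-iut cell's repair of finding F-L2d2-1, `PerfFactorialWeak.lean`) and `M^rlf` is
`IsPerfFactorialWeak.Rlf` — the SAME carrier `{a ∈ M^rlf_factor | Supp(a) ⊆ Supp(b), b ∈ M^pf}`, so every
proof is the one of `RlfStructure.lean` verbatim (none of them uses clause (d)).  First third of the proof
that **the realification of a weakly perf-factorial monoid is perf-factorial AS PRINTED** (F-L2d2-2
follow-up; files `RlfPrimesWeak.lean`, `RlfPerfFactorialWeak.lean`):

* `M^rlf` is perfect (`IsPerfFactorialWeak.Rlf.isPerfect`), sharp, integral and saturated, i.e.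
  **divisorial** (`IsPerfFactorialWeak.Rlf.isDivisorial`) — condition (a) of Def. 2.4 (i) for `M^rlf`;
* the order of `M^rlf` is componentwise (`Rlf.dvd_iff`);
* every prime occurs in the support of the factorization of one of its primary generators
  (`mem_supp_factorMap_of_mem_carrier`, via the weak sup calculus `IsPerfFactorialWeak.of_dvd_factorMap`
  of `PerfFactorialWeakFinite.lean`), so `single' 𝔮 y ∈ M^rlf` (`IsPerfFactorialWeak.single`,
  `restrict`, `restrictHom`; `single'` itself is the `h`-free `IsPerfFactorial.single'`).

Port by seat abc-iut-L2-d2 (cell abc-iut), credited to abc-iut-L1-d2's originals; no statement of the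
paper is strengthened.  HONEST FRAMING: classical monoid algebra; nothing here bears on [IUTchIII] Cor. 3.12.
-/

noncomputable section

namespace Literature.AlgebraicGeometry.Frobenioids

open Function IsPerfFactorial

universe u

/-! ### `M^rlf` (weak): perfect and divisorial -/

namespace IsPerfFactorialWeak

variable {M : Type u} [CommMonoid M]

/-- Membership in `M^rlf`: `Supp(a) ⊆ Supp(b)` for some `b ∈ M^pf`. [cite: MochizukiFrdI2008, Def. 2.4(i) p.48] -/
theorem mem_realification_iff (h : IsPerfFactorialWeak M) (a : RlfFactor M) :
    a ∈ h.realification ↔ ∃ b : Perfection M, supp a ⊆ supp (factorMap M b) := Iff.rfl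

namespace Rlf

/-- Components of a product in `M^rlf`. [cite: MochizukiFrdI2008, Def. 2.4(i) p.48] -/
@[simp] theorem coe_mul (h : IsPerfFactorialWeak M) (a b : h.Rlf) : ((a * b : h.Rlf) : RlfFactor M) = (a : RlfFactor M) * b := rfl

/-- Components of a power in `M^rlf`. [cite: MochizukiFrdI2008, Def. 2.4(i) p.48] -/
@[simp] theorem coe_pow (h : IsPerfFactorialWeak M) (a : h.Rlf) (n : ℕ) : ((a ^ n : h.Rlf) : RlfFactor M) = (a : RlfFactor M) ^ n := rfl

/-- Components of `1 ∈ M^rlf`. [cite: MochizukiFrdI2008, Def. 2.4(i) p.48] -/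
@[simp] theorem coe_one (h : IsPerfFactorialWeak M) : ((1 : h.Rlf) : RlfFactor M) = 1 := rfl

/-- `M^rlf` is sharp (each `M^rlf_𝔮` is). [cite: MochizukiFrdI2008, Def. 2.4(i) p.48] -/
theorem isSharp (h : IsPerfFactorialWeak M) : IsSharp h.Rlf := by
  refine ⟨fun a ha => ?_⟩
  obtain ⟨b, hab⟩ := ha.exists_right_inv
  apply Subtype.ext
  funext 𝔮
  have h𝔮 : (a : RlfFactor M) 𝔮 * (b : RlfFactor M) 𝔮 = 1 := by
    rw [← Pi.mul_apply, ← coe_mul, hab, coe_one, Pi.one_apply]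
  exact (isSharp_realification _).1 _ (IsUnit.of_mul_eq_one _ h𝔮)

/-- `M^rlf` is cancellative (each `M^rlf_𝔮` is). [cite: MochizukiFrdI2008, Def. 2.4(i) p.48] -/
theorem isCancelMul (h : IsPerfFactorialWeak M) : IsCancelMul h.Rlf where
  mul_left_cancel a := by
    intro b c hbc
    apply Subtype.ext
    funext 𝔮
    have := congrArg (fun z : h.Rlf => (z : RlfFactor M) 𝔮) hbc
    simp only [coe_mul, Pi.mul_apply] at this
    exact Realification.mul_left_cancel' this
  mul_right_cancel a := by
    intro b c hbc
    apply Subtype.ext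
    funext 𝔮
    have := congrArg (fun z : h.Rlf => (z : RlfFactor M) 𝔮) hbc
    simp only [coe_mul, Pi.mul_apply] at this
    rw [mul_comm ((b : RlfFactor M) 𝔮), mul_comm ((c : RlfFactor M) 𝔮)] at this
    exact Realification.mul_left_cancel' this

/-- `M^rlf` is integral. [cite: MochizukiFrdI2008, Def. 2.4(i) p.48] -/
theorem isIntegral (h : IsPerfFactorialWeak M) : IsIntegral h.Rlf :=
  isIntegral_iff_isCancelMul.mpr (isCancelMul h)

/-- Componentwise `n`-th roots preserve `M^rlf`. [cite: MochizukiFrdI2008, Def. 2.4(i) p.48] -/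
theorem root_mem (h : IsPerfFactorialWeak M) (n : ℕ+) (a : h.Rlf) :
    (fun 𝔮 => Realification.root n ((a : RlfFactor M) 𝔮)) ∈ h.realification := by
  obtain ⟨b, hb⟩ := a.2
  refine ⟨b, fun 𝔮 h𝔮 => hb ?_⟩
  simp only [supp, Set.mem_setOf_eq, ne_eq, Realification.root_eq_one_iff] at h𝔮 ⊢
  exact h𝔮

/-- The componentwise `n`-th root in `M^rlf`. [cite: MochizukiFrdI2008, Def. 2.4(i) p.48] -/
def root (h : IsPerfFactorialWeak M) (n : ℕ+) (a : h.Rlf) : h.Rlf := ⟨_, root_mem h n a⟩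

/-- `(root n a)^n = a` in `M^rlf`. [cite: MochizukiFrdI2008, Def. 2.4(i) p.48] -/
theorem root_pow (h : IsPerfFactorialWeak M) (n : ℕ+) (a : h.Rlf) : root h n a ^ (n : ℕ) = a := by
  apply Subtype.ext
  funext 𝔮
  rw [coe_pow, Pi.pow_apply]
  exact Realification.root_pow n _

/-- **`M^rlf` is perfect.** [cite: MochizukiFrdI2008, Def. 2.4(i) p.48] -/
theorem isPerfect (h : IsPerfFactorialWeak M) : IsPerfect h.Rlf := by
  refine ⟨fun n hn => ⟨fun a b hab => ?_, fun b => ⟨root h ⟨n, hn⟩ b, root_pow h ⟨n, hn⟩ b⟩⟩⟩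
  apply Subtype.ext
  funext 𝔮
  have := congrArg (fun z : h.Rlf => (z : RlfFactor M) 𝔮) hab
  simp only [coe_pow, Pi.pow_apply] at this
  exact Realification.pow_injective hn this

/-- Every element of `M^gp` is a quotient of two elements of `M`. [folklore] -/
private theorem gp_exists_eq_div' {N : Type u} [CommMonoid N] (x : Algebra.GrothendieckGroup N) :
    ∃ a b : N, x = Algebra.GrothendieckGroup.of a / Algebra.GrothendieckGroup.of b := by
  obtain ⟨⟨a, b⟩, hx⟩ := (Localization.monoidOf (⊤ : Submonoid N)).surj x
  exact ⟨a, b, eq_div_iff_mul_eq'.mpr hx⟩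

/-- **`M^rlf` is saturated**: if `x ∈ (M^rlf)^gp` has `x^n ∈ M^rlf`, take `n`-th roots.
[cite: MochizukiFrdI2008, Def. 2.4(i) p.48] -/
theorem isSaturated (h : IsPerfFactorialWeak M) : IsSaturated h.Rlf := by
  have hof : Injective (Algebra.GrothendieckGroup.of (M := h.Rlf)) := (isIntegral h).1
  refine ⟨fun x n hn ⟨w, hw⟩ => ?_⟩
  obtain ⟨u, v, rfl⟩ := gp_exists_eq_div' x
  have h1 : u ^ n = w * v ^ n := hof (by rw [map_mul, map_pow, map_pow, hw, div_pow, div_mul_cancel])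
  let nn : ℕ+ := ⟨n, hn⟩
  have h2 : u = root h nn w * v := by
    apply (isPerfect h).1 n hn |>.1
    dsimp only
    have e1 : root h nn w ^ n = w := root_pow h nn w
    rw [mul_pow, e1, h1]
  exact ⟨root h nn w, by rw [h2, map_mul, mul_div_cancel_right]⟩

/-- `M^rlf` is of characteristic type (it is sharp). [cite: MochizukiFrdI2008, Def. 2.4(i) p.48] -/
theorem isOfCharType (h : IsPerfFactorialWeak M) : IsOfCharType h.Rlf :=
  ⟨fun u _ _ => Units.ext ((isSharp h).1 _ u.isUnit)⟩

/-- **`M^rlf` is divisorial** — condition (a) of Def. 2.4 (i) for `M^rlf`. [cite: MochizukiFrdI2008, Def. 2.4(i) p.48] -/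
theorem isDivisorial (h : IsPerfFactorialWeak M) : IsDivisorial h.Rlf where
  isPreDivisorial :=
    { isIntegral := isIntegral h
      isSaturated := isSaturated h
      isOfCharType := isOfCharType h }
  isSharp := isSharp h

/-! ### The order of `M^rlf` is componentwise -/

/-- **`a ≤ b` in `M^rlf` iff `a_𝔮 ≤ b_𝔮` in every `M^rlf_𝔮`.** [cite: MochizukiFrdI2008, Def. 2.4(i) p.48] -/
theorem dvd_iff (h : IsPerfFactorialWeak M) (a b : h.Rlf) : a ∣ b ↔ ∀ 𝔮, (a : RlfFactor M) 𝔮 ∣ (b : RlfFactor M) 𝔮 := by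
  constructor
  · rintro ⟨c, rfl⟩ 𝔮
    exact ⟨(c : RlfFactor M) 𝔮, rfl⟩
  · intro hab
    choose c hc using hab
    have hbc : (b : RlfFactor M) = (a : RlfFactor M) * c := funext hc
    have hcmem : c ∈ h.realification := by
      obtain ⟨b₀, hb₀⟩ := b.2
      refine ⟨b₀, fun 𝔮 h𝔮 => hb₀ ?_⟩
      rw [hbc, mul_comm]
      exact supp_subset_supp_mul _ _ h𝔮
    exact ⟨⟨c, hcmem⟩, Subtype.ext hbc⟩

/-- `a ≼ b` in `M^rlf` iff `∃ n ≥ 1, a_𝔮 ≤ n · b_𝔮` for every `𝔮`. [cite: MochizukiFrdI2008, Def. 2.4(i) p.48] -/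
theorem precsim_iff (h : IsPerfFactorialWeak M) (a b : h.Rlf) :
    a ≼ b ↔ ∃ n : ℕ, 0 < n ∧ ∀ 𝔮, (a : RlfFactor M) 𝔮 ∣ (b : RlfFactor M) 𝔮 ^ n := by
  simp only [Precsim, dvd_iff, coe_pow, Pi.pow_apply]

/-- `a ∣ b` in `M^rlf` implies `Supp(a) ⊆ Supp(b)`. [cite: MochizukiFrdI2008, Def. 2.4(i) p.48] -/
theorem supp_subset_of_dvd (h : IsPerfFactorialWeak M) {a b : h.Rlf} (hab : a ∣ b) : supp (a : RlfFactor M) ⊆ supp (b : RlfFactor M) := by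
  obtain ⟨c, rfl⟩ := hab
  rw [coe_mul]
  exact supp_subset_supp_mul _ _

/-- `a ≼ b` in `M^rlf` implies `Supp(a) ⊆ Supp(b)`. [cite: MochizukiFrdI2008, Def. 2.4(i) p.48] -/
theorem supp_subset_of_precsim (h : IsPerfFactorialWeak M) {a b : h.Rlf} (hab : a ≼ b) : supp (a : RlfFactor M) ⊆ supp (b : RlfFactor M) := by
  obtain ⟨n, hn, hab⟩ := hab
  have := supp_subset_of_dvd h hab
  rwa [coe_pow, supp_pow _ hn] at this

/-- `a ≠ 1` in `M^rlf` iff `Supp(a)` is nonempty. [cite: MochizukiFrdI2008, Def. 2.4(i) p.48] -/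
theorem ne_one_iff_supp_nonempty (h : IsPerfFactorialWeak M) (a : h.Rlf) : a ≠ 1 ↔ (supp (a : RlfFactor M)).Nonempty := by
  rw [Set.nonempty_iff_ne_empty, ne_eq, ne_eq, not_iff_not]
  constructor
  · rintro rfl
    ext 𝔮
    simp [supp]
  · intro hs
    apply Subtype.ext
    funext 𝔮
    by_contra h𝔮
    have : 𝔮 ∈ supp (a : RlfFactor M) := h𝔮
    rw [hs] at this
    exact this

end Rlf

/-! ### Elements of `M^rlf` supported at one prime -/

/-- Every prime `𝔮 ∈ Prime(M^pf)` lies in the support of the factorization of each of its primary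
elements (for weakly perf-factorial `M`; the sup calculus of clause (c), `PerfFactorialWeakFinite.lean`). [cite: MochizukiFrdI2008, Def. 2.4(i) p.47] -/
theorem mem_supp_factorMap_of_mem_carrier (h : IsPerfFactorialWeak M) {𝔮 : Primes (Perfection M)}
    {x : Perfection M} (hx : x ∈ 𝔮.carrier) : 𝔮 ∈ supp (factorMap M x) := by
  intro h1
  have hx1 : x ≠ 1 := hx.1.1
  have hxmem : x ∈ 𝔮.submonoid := Submonoid.subset_closure hx
  have hdvd := h.of_dvd_factorMap ⟨x, hxmem⟩ (Or.inl hx) dvd_rfl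
  rw [h1] at hdvd
  have hunit := (isSharp_realification _).1 _ (isUnit_of_dvd_one hdvd)
  have hinj := Realification.of_injective
    (isMonoprime_submonoid_primes_perfection h.isDivisorial.isSharp h.isMonoprime 𝔮)
  have : (⟨x, hxmem⟩ : PfAt M 𝔮) = 1 := hinj (by rw [hunit, map_one])
  exact hx1 (congrArg Subtype.val this)

/-- Every prime occurs in the support of the factorization of some element of `M^pf`.
[cite: MochizukiFrdI2008, Def. 2.4(i) p.47] -/
theorem exists_mem_supp_factorMap (h : IsPerfFactorialWeak M) (𝔮 : Primes (Perfection M)) :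
    ∃ b : Perfection M, 𝔮 ∈ supp (factorMap M b) := by
  induction 𝔮 using Quotient.inductionOn with
  | h x => exact ⟨x.1, h.mem_supp_factorMap_of_mem_carrier ⟨x.2, rfl⟩⟩

/-- For weakly perf-factorial `M`, `single' 𝔮 y ∈ M^rlf` for every `y ∈ M^rlf_𝔮`.
[cite: MochizukiFrdI2008, Def. 2.4(i) p.48] -/
theorem single'_mem_realification (h : IsPerfFactorialWeak M) (𝔮 : Primes (Perfection M)) (y : RlfAt M 𝔮) :
    single' 𝔮 y ∈ h.realification := by
  obtain ⟨b, hb⟩ := h.exists_mem_supp_factorMap 𝔮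
  exact ⟨b, (supp_single'_subset 𝔮 y).trans (Set.singleton_subset_iff.mpr hb)⟩

/-- **The element of `M^rlf` supported at `𝔮` with component `y`.** [cite: MochizukiFrdI2008, Def. 2.4(i) p.48] -/
def single (h : IsPerfFactorialWeak M) (𝔮 : Primes (Perfection M)) (y : RlfAt M 𝔮) : h.Rlf := ⟨single' 𝔮 y, h.single'_mem_realification 𝔮 y⟩

/-- Components of `single`. [cite: MochizukiFrdI2008, Def. 2.4(i) p.48] -/
@[simp] theorem coe_single (h : IsPerfFactorialWeak M) (𝔮 : Primes (Perfection M)) (y : RlfAt M 𝔮) : (h.single 𝔮 y : RlfFactor M) = single' 𝔮 y := rfl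

/-- The restriction of `a ∈ M^rlf` to the prime `𝔮`: `single 𝔮 a_𝔮`. [cite: MochizukiFrdI2008, Def. 2.4(i) p.48] -/
def restrict (h : IsPerfFactorialWeak M) (𝔮 : Primes (Perfection M)) (a : h.Rlf) : h.Rlf := h.single 𝔮 ((a : RlfFactor M) 𝔮)

/-- `restrict` is a monoid homomorphism. [cite: MochizukiFrdI2008, Def. 2.4(i) p.48] -/
def restrictHom (h : IsPerfFactorialWeak M) (𝔮 : Primes (Perfection M)) : h.Rlf →* h.Rlf where
  toFun := h.restrict 𝔮
  map_one' := Subtype.ext (by simp [restrict])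
  map_mul' a b := Subtype.ext (by simp [restrict, single'_mul])

/-- `restrictHom` is `restrict`. [cite: MochizukiFrdI2008, Def. 2.4(i) p.48] -/
@[simp] theorem restrictHom_apply (h : IsPerfFactorialWeak M) (𝔮 : Primes (Perfection M)) (a : h.Rlf) : h.restrictHom 𝔮 a = h.restrict 𝔮 a := rfl

/-- Components of `restrict`. [cite: MochizukiFrdI2008, Def. 2.4(i) p.48] -/
@[simp] theorem coe_restrict (h : IsPerfFactorialWeak M) (𝔮 : Primes (Perfection M)) (a : h.Rlf) :
    (h.restrict 𝔮 a : RlfFactor M) = single' 𝔮 ((a : RlfFactor M) 𝔮) := rfl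

/-- `restrict 𝔮 a ≤ a`. [cite: MochizukiFrdI2008, Def. 2.4(i) p.48] -/
theorem restrict_dvd (h : IsPerfFactorialWeak M) (𝔮 : Primes (Perfection M)) (a : h.Rlf) : h.restrict 𝔮 a ∣ a := by
  rw [Rlf.dvd_iff]
  intro 𝔮'
  rw [coe_restrict]
  by_cases h𝔮 : 𝔮' = 𝔮
  · subst h𝔮
    rw [single'_apply_same]
  · rw [single'_apply_of_ne h𝔮]
    exact one_dvd _

/-- `Supp(restrict 𝔮 a) ⊆ {𝔮}`. [cite: MochizukiFrdI2008, Def. 2.4(i) p.48] -/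
theorem supp_restrict_subset (h : IsPerfFactorialWeak M) (𝔮 : Primes (Perfection M)) (a : h.Rlf) :
    supp (h.restrict 𝔮 a : RlfFactor M) ⊆ {𝔮} :=
  supp_single'_subset 𝔮 _

/-- `Supp(restrict 𝔮 a) ⊆ Supp(a)`. [cite: MochizukiFrdI2008, Def. 2.4(i) p.48] -/
theorem supp_restrict_subset_supp (h : IsPerfFactorialWeak M) (𝔮 : Primes (Perfection M)) (a : h.Rlf) :
    supp (h.restrict 𝔮 a : RlfFactor M) ⊆ supp (a : RlfFactor M) :=
  Rlf.supp_subset_of_dvd h (h.restrict_dvd 𝔮 a)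

end IsPerfFactorialWeak

end Literature.AlgebraicGeometry.Frobenioids
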